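import Mathlib.Analysis.SpecialFunctions.Log.Basic
import Mathlib.Analysis.SpecialFunctions.ExpDeriv
import Mathlib.Analysis.Calculus.Deriv.MeanValue
import Mathlib.Analysis.Calculus.Deriv.Inv
import HarnessLib

/-!
# C164 `Piromthan2025` — SALVAGE (a) TRUE-column twin: the damped Riccati LOWER bound
# `W′ ≥ AW² − BW` with `AW(0) > B` cannot be continued past `(1/B)·log(AW(0)/(AW(0) − B)) ≤ 1/(AW(0) − B)`

Cell `ns-claims` (D-0090), lane ns-claims-salvage-p6 g3, records-grade (no token effect). The text of
record (Zenodo 15737494) prints, p.4 l.1–12: «The general solution to (7) blows up in finite time if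
AW(0) > B, with blowup time bounded above by T* ≤ 1/(AW(0) − B)», where (7) is
«dW/dt ≥ AW(t)² − BW(t), for constants A, B > 0» (p.3 l.43–48). As a statement about real functions
this is TRUE, and it is the only thing proved here: a positive function `W`, continuous on `[0,T)` and
differentiable on `(0,T)` with `W′ ≥ AW² − BW` there (`B > 0`) and `AW(0) > B`, forces
`T ≤ (1/B)·log(AW(0)/(AW(0) − B))` (`noncontinuation`), and that time is `≤ 1/(AW(0) − B)`
(`log_bound_le_inv`), hence `T ≤ 1/(AW(0) − B)` (`noncontinuation'`). Proof: the Bernoulli variable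
`z = 1/W` satisfies `z′ ≤ −A + Bz`, so `(z − A/B)e^{−Bt}` is non-increasing and
`0 < z(t) ≤ A/B + (z(0) − A/B)e^{Bt}` pins `t` below the printed time. Nothing about Navier–Stokes is
asserted; whether any vorticity functional obeys (7) is exactly what the row's VERDICT addresses.

WHAT THIS IS NOT: not a claim about NS regularity or blow-up; not a claim about any author beyond the
typed locator.
-/

set_option linter.dupNamespace false

noncomputable section

open Real Set

namespace Summit.NavierStokesRegularity.NavierStokesRegularity.Theorems.Piromthan2025Salvage

/-- **Non-continuation for the damped Riccati lower bound.** If `W > 0` is continuous on `[0,T)`,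
differentiable on `(0,T)`, satisfies `AW² − BW ≤ W′` there (`B > 0`; the sign of `A` is never used
beyond `A·W(0) > B`) and `B < A·W(0)`, then
`T ≤ (1/B)·log(AW(0)/(AW(0) − B))`. [cite: Piromthan2025, p.4 l.1–12 with (7) p.3 l.43–48] -/
theorem noncontinuation {W : ℝ → ℝ} {A B T : ℝ} (hB : 0 < B)
    (hcont : ContinuousOn W (Ico 0 T)) (hdiff : ∀ t ∈ Ioo 0 T, DifferentiableAt ℝ W t)
    (hpos : ∀ t ∈ Ico 0 T, 0 < W t)
    (hineq : ∀ t ∈ Ioo 0 T, A * W t ^ 2 - B * W t ≤ deriv W t) (h0 : B < A * W 0) :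
    T ≤ 1 / B * log (A * W 0 / (A * W 0 - B)) := by
  refine le_of_not_gt fun hT => ?_
  -- the printed time `t₁` lies in `(0, T)`
  set t₁ : ℝ := 1 / B * log (A * W 0 / (A * W 0 - B)) with ht₁
  have hAW0 : 0 < A * W 0 := hB.trans h0
  have hden : 0 < A * W 0 - B := sub_pos.2 h0
  have hratio : 1 < A * W 0 / (A * W 0 - B) := by
    rw [one_lt_div hden]; linarith
  have ht₁pos : 0 < t₁ := by
    have := Real.log_pos hratio
    positivity
  -- Bernoulli variable and the integrating factor
  set g : ℝ → ℝ := fun s => ((W s)⁻¹ - A / B) * exp (-B * s) with hg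
  have hIcc : Icc 0 t₁ ⊆ Ico 0 T := fun s hs => ⟨hs.1, hs.2.trans_lt hT⟩
  have hgcont : ContinuousOn g (Icc 0 t₁) := by
    have hWc : ContinuousOn W (Icc 0 t₁) := hcont.mono hIcc
    have hWinv : ContinuousOn (fun s => (W s)⁻¹) (Icc 0 t₁) :=
      hWc.inv₀ fun s hs => (hpos s (hIcc hs)).ne'
    exact (hWinv.sub continuousOn_const).mul (by fun_prop)
  have hgderiv : ∀ s ∈ interior (Icc 0 t₁), deriv g s ≤ 0 := by
    rw [interior_Icc]
    intro s hs
    have hsT : s ∈ Ioo 0 T := ⟨hs.1, hs.2.trans hT⟩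
    have hWs : 0 < W s := hpos s ⟨hs.1.le, hsT.2⟩
    have hWd : HasDerivAt W (deriv W s) s := (hdiff s hsT).hasDerivAt
    have hinv : HasDerivAt (fun r => (W r)⁻¹) (-(deriv W s) / (W s) ^ 2) s := hWd.inv hWs.ne'
    have hexp : HasDerivAt (fun r => exp (-B * r)) (exp (-B * s) * (-B)) s := by
      have := ((hasDerivAt_id s).const_mul (-B)).exp
      simpa [mul_comm] using this
    have hgd : HasDerivAt g
        ((-(deriv W s) / (W s) ^ 2) * exp (-B * s) + ((W s)⁻¹ - A / B) * (exp (-B * s) * (-B))) s :=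
      (hinv.sub_const (A / B)).mul hexp
    rw [hgd.deriv]
    have hE : 0 < exp (-B * s) := exp_pos _
    -- `z′ ≤ −A + Bz` written out: `−W′/W² ≤ −A + B/W`
    have hz : -(deriv W s) / (W s) ^ 2 ≤ -A + B * (W s)⁻¹ := by
      have hW2 : 0 < (W s) ^ 2 := by positivity
      rw [div_le_iff₀ hW2]
      have : (-A + B * (W s)⁻¹) * (W s) ^ 2 = -(A * W s ^ 2 - B * W s) := by
        field_simp
        ring
      rw [this]
      linarith [hineq s hsT]
    have hBne : B ≠ 0 := hB.ne'
    have : (-(deriv W s) / (W s) ^ 2) * exp (-B * s) + ((W s)⁻¹ - A / B) * (exp (-B * s) * (-B))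
        = (-(deriv W s) / (W s) ^ 2 - (-A + B * (W s)⁻¹)) * exp (-B * s) := by
      field_simp
      ring
    rw [this]
    exact mul_nonpos_of_nonpos_of_nonneg (sub_nonpos.2 hz) hE.le
  have hgdiff : DifferentiableOn ℝ g (interior (Icc 0 t₁)) := by
    rw [interior_Icc]
    intro s hs
    have hsT : s ∈ Ioo 0 T := ⟨hs.1, hs.2.trans hT⟩
    have hWs : 0 < W s := hpos s ⟨hs.1.le, hsT.2⟩
    have h1 : DifferentiableAt ℝ (fun r => (W r)⁻¹) s := (hdiff s hsT).inv hWs.ne'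
    exact ((h1.sub_const (A / B)).mul (by fun_prop)).differentiableWithinAt
  have hanti : AntitoneOn g (Icc 0 t₁) :=
    antitoneOn_of_deriv_nonpos (convex_Icc 0 t₁) hgcont hgdiff hgderiv
  -- at `t₁`: `z(t₁) ≤ A/B + (z(0) − A/B) e^{B t₁} = 0`, contradicting `W(t₁) > 0`
  have hg1 : g t₁ ≤ g 0 := hanti (left_mem_Icc.2 ht₁pos.le) (right_mem_Icc.2 ht₁pos.le) ht₁pos.le
  have hWt₁ : 0 < W t₁ := hpos t₁ ⟨ht₁pos.le, hT⟩
  have hg0 : g 0 = (W 0)⁻¹ - A / B := by simp [hg]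
  have hexp1 : exp (B * t₁) = A * W 0 / (A * W 0 - B) := by
    rw [ht₁, ← mul_assoc, mul_one_div_cancel hB.ne', one_mul]
    exact exp_log (by positivity)
  have hz1 : (W t₁)⁻¹ ≤ A / B + ((W 0)⁻¹ - A / B) * exp (B * t₁) := by
    have hE : 0 < exp (-B * t₁) := exp_pos _
    have : g t₁ = ((W t₁)⁻¹ - A / B) * exp (-B * t₁) := rfl
    rw [this, hg0] at hg1
    have h2 : ((W t₁)⁻¹ - A / B) ≤ ((W 0)⁻¹ - A / B) * exp (B * t₁) := by
      have h3 := mul_le_mul_of_nonneg_right hg1 (exp_pos (B * t₁)).le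
      rwa [mul_assoc, ← Real.exp_add, show -B * t₁ + B * t₁ = 0 by ring, exp_zero, mul_one] at h3
    linarith
  have hW0 : W 0 ≠ 0 := by
    intro h
    rw [h, mul_zero] at hAW0
    exact lt_irrefl 0 hAW0
  have hden' : A * W 0 - B ≠ 0 := hden.ne'
  have hBne : B ≠ 0 := hB.ne'
  have hzero : A / B + ((W 0)⁻¹ - A / B) * exp (B * t₁) = 0 := by
    rw [hexp1, div_add' _ _ _ hBne, div_eq_zero_iff]
    left
    field_simp
    ring
  have : (W t₁)⁻¹ ≤ 0 := hz1.trans hzero.le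
  exact absurd this (not_le.2 (inv_pos.2 hWt₁))

/-- The printed time bound: `(1/B)·log(AW₀/(AW₀ − B)) ≤ 1/(AW₀ − B)` when `A, B > 0` and `B < AW₀`
(`log x ≤ x − 1`). [cite: Piromthan2025, p.4 l.1–12] -/
theorem log_bound_le_inv {A B W₀ : ℝ} (hB : 0 < B) (h0 : B < A * W₀) :
    1 / B * log (A * W₀ / (A * W₀ - B)) ≤ 1 / (A * W₀ - B) := by
  have hden : 0 < A * W₀ - B := sub_pos.2 h0
  have hx : 0 < A * W₀ / (A * W₀ - B) := by
    have : 0 < A * W₀ := hB.trans h0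
    positivity
  have hlog : log (A * W₀ / (A * W₀ - B)) ≤ A * W₀ / (A * W₀ - B) - 1 := log_le_sub_one_of_pos hx
  have hrhs : A * W₀ / (A * W₀ - B) - 1 = B / (A * W₀ - B) := by
    field_simp
    ring
  rw [hrhs] at hlog
  calc 1 / B * log (A * W₀ / (A * W₀ - B)) ≤ 1 / B * (B / (A * W₀ - B)) :=
        mul_le_mul_of_nonneg_left hlog (by positivity)
    _ = 1 / (A * W₀ - B) := by field_simp

/-- **The printed statement p.4 l.1–12, as a fact about real functions**: under the hypotheses of
`noncontinuation`, `T ≤ 1/(AW(0) − B)`. [cite: Piromthan2025, p.4 l.1–12 with (7) p.3 l.43–48] -/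
theorem noncontinuation' {W : ℝ → ℝ} {A B T : ℝ} (hB : 0 < B)
    (hcont : ContinuousOn W (Ico 0 T)) (hdiff : ∀ t ∈ Ioo 0 T, DifferentiableAt ℝ W t)
    (hpos : ∀ t ∈ Ico 0 T, 0 < W t)
    (hineq : ∀ t ∈ Ioo 0 T, A * W t ^ 2 - B * W t ≤ deriv W t) (h0 : B < A * W 0) :
    T ≤ 1 / (A * W 0 - B) :=
  (noncontinuation hB hcont hdiff hpos hineq h0).trans (log_bound_le_inv hB h0)

end Summit.NavierStokesRegularity.NavierStokesRegularity.Theorems.Piromthan2025Salvage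

end
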